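import Mathlib
import Summits.NavierStokesRegularity.NavierStokesRegularity.Theorems.L3TimeExponentPincerRingDatumMeasure
import Literature.Analysis.FluidPDE.AxisymNoSwirlImpulseWeights
import HarnessLib.Audit
import HarnessLib

/-!
# L3TimeExponentPincer — ring datum calculus XV: moments of `ω_θ/r` from its sign zones

Support kernel for the crux `L3CascadeJaw` (item stmt-NavierStokesRegularity-19499): turns the
sign-zone structure of `η₀ = ω_θ/r` of the glued-dipole ring datum (`…RingDatumEtaSupport`:
`η₀ ≤ M_c`, `η₀ ≤ 0` off the core ball of radius `ρ_c`, `−M_s ≤ η₀`, `η₀⁻ = 0` off the shell ball of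
radius `ρ_s`) into the three moment hypotheses of `lpPersistence_of_ringData` by sup × volume
(`…RingDatumMeasure`), for an ABSTRACT real function `η` on `ℝ³`:

* `lintegral_negPart_le` — `∫⁻ ofReal (η⁻) ≤ ofReal (M_s ρ_s³ V₁)`;
* `lintegral_rsq_posPart_le` — `∫⁻ ofReal (r² η⁺) ≤ ofReal (ρ_c² M_c ρ_c³ V₁)`;
* `lintegral_rsq_negPart_le` — `∫⁻ ofReal (r² η⁻) ≤ ofReal (ρ_s² M_s ρ_s³ V₁)`.

(The `L¹` mass `∫|η| ≤ M_c ρ_c³ V₁ + M_s ρ_s³ V₁` follows the same way from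
`integral_abs_le_of_le_of_support` applied to the core and shell pieces; left to the assembly.)

(`V₁ = volume.real (ball 0 1)`; `r = cylRadius ≤ ‖x‖`, tree `cylRadius_sq_le_norm_sq`.)
WHAT THIS IS NOT: measure bookkeeping only.
-/

namespace Summit.NavierStokesRegularity.NavierStokesRegularity.Theorems.L3TimeExponentPincerRingDatumMoments

open Real Set Metric MeasureTheory Literature.Analysis.FluidPDE
open Summit.NavierStokesRegularity.NavierStokesRegularity.Theorems.L3TimeExponentPincerRingDatumMeasure
open scoped ENNReal

variable {η : EuclideanSpace ℝ (Fin 3) → ℝ} {Mc Ms ρc ρs : ℝ}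

/-- **Negative-part mass** (`mneg`): if `−M_s ≤ η` (`0 ≤ M_s`) and `η ≥ 0` off the closed ball of
radius `ρ_s ≥ 0`, then `∫⁻ ofReal (η⁻) ≤ ofReal (M_s ρ_s³ V₁)`. -/
theorem lintegral_negPart_le (hMs : 0 ≤ Ms) (hρs : 0 ≤ ρs) (hlow : ∀ x, -Ms ≤ η x)
    (hpos : ∀ x, ρs < ‖x‖ → 0 ≤ η x) :
    ∫⁻ x, ENNReal.ofReal ((η x)⁻) ≤
      ENNReal.ofReal (Ms * ρs ^ 3 * (volume (ball (0 : EuclideanSpace ℝ (Fin 3)) 1)).toReal) := by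
  refine lintegral_ofReal_le_of_le_of_support hMs hρs (fun x => ?_) (fun x hx => ?_)
  · rw [negPart_def]
    exact max_le (by linarith [hlow x]) hMs
  · rw [negPart_def]
    exact max_le (by linarith [hpos x hx]) le_rfl

/-- **Positive `r²`-moment** (`P`, core): if `η ≤ M_c` (`0 ≤ M_c`) and `η ≤ 0` off the closed ball
of radius `ρ_c ≥ 0`, then `∫⁻ ofReal (r² η⁺) ≤ ofReal (ρ_c² M_c ρ_c³ V₁)`. -/
theorem lintegral_rsq_posPart_le (hMc : 0 ≤ Mc) (hρc : 0 ≤ ρc) (hup : ∀ x, η x ≤ Mc)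
    (hnonpos : ∀ x, ρc < ‖x‖ → η x ≤ 0) :
    ∫⁻ x, ENNReal.ofReal (cylRadius x ^ 2 * (η x)⁺) ≤
      ENNReal.ofReal (ρc ^ 2 * Mc * ρc ^ 3 * (volume (ball (0 : EuclideanSpace ℝ (Fin 3)) 1)).toReal) := by
  refine lintegral_ofReal_le_of_le_of_support (by positivity) hρc (fun x => ?_) (fun x hx => ?_)
  · rcases le_or_gt ‖x‖ ρc with hx | hx
    · have h1 : cylRadius x ^ 2 ≤ ρc ^ 2 :=
        (cylRadius_sq_le_norm_sq x).trans (pow_le_pow_left₀ (norm_nonneg _) hx 2)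
      have h2 : (η x)⁺ ≤ Mc := by rw [posPart_def]; exact max_le (hup x) hMc
      calc cylRadius x ^ 2 * (η x)⁺ ≤ ρc ^ 2 * Mc :=
            mul_le_mul h1 h2 (posPart_nonneg _) (sq_nonneg _)
        _ = ρc ^ 2 * Mc := rfl
    · have h0 : (η x)⁺ = 0 := by rw [posPart_eq_zero]; exact hnonpos x hx
      rw [h0, mul_zero]; positivity
  · have h0 : (η x)⁺ = 0 := by rw [posPart_eq_zero]; exact hnonpos x hx
    rw [h0, mul_zero]

/-- **Negative `r²`-moment** (`P`, shell): if `−M_s ≤ η` (`0 ≤ M_s`) and `η ≥ 0` off the closed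
ball of radius `ρ_s ≥ 0`, then `∫⁻ ofReal (r² η⁻) ≤ ofReal (ρ_s² M_s ρ_s³ V₁)`. -/
theorem lintegral_rsq_negPart_le (hMs : 0 ≤ Ms) (hρs : 0 ≤ ρs) (hlow : ∀ x, -Ms ≤ η x)
    (hpos : ∀ x, ρs < ‖x‖ → 0 ≤ η x) :
    ∫⁻ x, ENNReal.ofReal (cylRadius x ^ 2 * (η x)⁻) ≤
      ENNReal.ofReal (ρs ^ 2 * Ms * ρs ^ 3 * (volume (ball (0 : EuclideanSpace ℝ (Fin 3)) 1)).toReal) := by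
  have h := lintegral_rsq_posPart_le (η := fun x => -η x) hMs hρs (fun x => by linarith [hlow x])
    (fun x hx => by linarith [hpos x hx])
  have e : ∀ x, (η x)⁻ = (-η x)⁺ := fun x => by rw [negPart_def, posPart_def]
  simp only [e]
  exact h

end Summit.NavierStokesRegularity.NavierStokesRegularity.Theorems.L3TimeExponentPincerRingDatumMoments
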